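import Literature.Geometry.Lorentzian.CoordRicciWaveGauge
import Literature.Geometry.Lorentzian.CoordScalarCurvatureEvolution
import HarnessLib

/-!
# Wave (harmonic) coordinates and the contracted Christoffel symbols

Coordinate tensor calculus (namespace `MetricCoord`, `CoordCurvature.lean` ff.). For components
`G : E → (E →L E →L ℝ)` of a pseudo-Riemannian metric, a basis `b` of `E` and a point `x` we
relate the coordinate wave operator applied to the coordinate functions `bᵃ = b.coord a`
(`lapAt G bᵃ x = Σ g^{kl} (∂ₖ∂ₗ bᵃ − bᵃ(Γ(b_k, b_l)))`, `CoordScalarCurvatureEvolution.lean`) to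
the lowered contracted Christoffel symbols `Γ♭(x, W) = Σ gⁱʲ G_x(Γ(bᵢ,bⱼ), W)` (`gaugeFun`,
`CoordRicciWaveGauge.lean`):

* `lapAt_coordCLM` — **`□_g bᵃ = −Γᵃ`**: `lapAt G bᵃ x = − bᵃ(Σ_{kl} g^{kl} Γ(b_k, b_l))` (the
  contracted Christoffel vector `Γᵃ bₐ` is written out as this double sum throughout; the coordinate
  functions have vanishing second derivatives; Hawking–Ellis 1973, §7.5, text after (7.46):
  "the coordinates are harmonic, `x^a{}_{;bc} g^{bc} = 0`, iff `Γᵃ = g^{bc} Γᵃ_{bc} = 0`";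
  Wald 1984, (10.2.33)–(10.2.34); Ringström 2009, §14.1);
* `gaugeFun_eq_apply_contrChr` — `Γ♭(x, W) = G_x(Σ g^{kl} Γ(b_k, b_l), W)`;
* `contrChr_eq_zero_of_lapAt_coordCLM_eq_zero`, `gaugeFun_eq_zero_of_lapAt_coordCLM_eq_zero` —
  **harmonic coordinates are wave-gauge coordinates**: if `□_g bᵃ = 0` at `x` for every `a`, then
  `Σ g^{kl} Γ(b_k, b_l) = 0` and `Γ♭(x, ·) = 0`; and the converse
  `lapAt_coordCLM_eq_zero_of_gaugeFun_eq_zero` at points where `G x` is invertible.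

This is the (pointwise, algebraic) link between harmonic coordinates — solutions of the wave
equation used as coordinates — and the wave-gauge form of the vacuum Einstein equations
(`IsMetricOn.ricAt_eq_of_gaugeFun_eq_zero`). Everything is proved; no definitions, no named facts.

## References

* S. W. Hawking, G. F. R. Ellis, *The large scale structure of space-time*, CUP 1973, §7.5,
  (7.42)–(7.46), (7.51). [HawkingEllis1973CUP]
* R. M. Wald, *General Relativity*, Chicago 1984, §10.2, (10.2.33)–(10.2.34). [Wald1984]
* B. O'Neill, *Semi-Riemannian geometry*, Academic Press 1983, Ch. 3, Prop. 3.13, Def. 3.50.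
  [ONeill1983]
-/

noncomputable section

set_option maxSynthPendingDepth 3

open Set Filter ContinuousLinearMap Module
open scoped Topology ContDiff

namespace Literature.Geometry.Lorentzian

namespace MetricCoord

variable {E : Type*} [NormedAddCommGroup E] [NormedSpace ℝ E]
variable {ι : Type*} [Fintype ι] [FiniteDimensional ℝ E] (b : Basis ι ℝ E)
  (G : E → E →L[ℝ] E →L[ℝ] ℝ) (x : E)

omit [Fintype ι] in
/-- The second derivative of a continuous linear functional vanishes. [folklore] -/
theorem fderiv_fderiv_coordCLM (a : ι) :
    fderiv ℝ (fderiv ℝ (coordCLM b a : E → ℝ)) x = 0 := by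
  have h : fderiv ℝ (coordCLM b a : E → ℝ) = fun _ ↦ coordCLM b a := by
    funext y
    exact (coordCLM b a).fderiv
  rw [h]
  exact fderiv_const_apply _

/-- **`□_g bᵃ = −Γᵃ`**: the coordinate wave operator of the coordinate function `bᵃ` is minus the
`a`-th component of the contracted Christoffel vector,
`lapAt G bᵃ x = −bᵃ(Σ_{kl} g^{kl} Γ(b_k, b_l))`. [cite: Wald1984, §10.2 (10.2.34)] -/
theorem lapAt_coordCLM (a : ι) :
    lapAt G (coordCLM b a : E → ℝ) x =
      -b.coord a (∑ k, ∑ l, ginv G b x k l • chrAt G x (b k) (b l)) := by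
  rw [lapAt_eq_sum G b, map_sum, ← Finset.sum_neg_distrib]
  refine Finset.sum_congr rfl fun k _ ↦ ?_
  rw [map_sum, ← Finset.sum_neg_distrib]
  refine Finset.sum_congr rfl fun l _ ↦ ?_
  rw [fderiv_fderiv_coordCLM, (coordCLM b a).fderiv, map_smul, smul_eq_mul]
  simp only [zero_apply, coordCLM_apply, zero_sub, mul_neg]

/-- `bᵃ(Σ g^{kl} Γ(b_k, b_l)) = −lapAt G bᵃ x`. [cite: Wald1984, §10.2 (10.2.34)] -/
theorem coord_contrChr (a : ι) :
    b.coord a (∑ k, ∑ l, ginv G b x k l • chrAt G x (b k) (b l)) =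
      -lapAt G (coordCLM b a : E → ℝ) x := by
  rw [lapAt_coordCLM, neg_neg]

variable {G x} in
/-- **`Γ♭(x, W) = G_x(Γᵃ bₐ, W)`**: the lowered contracted Christoffel symbols are the metric dual
of the contracted Christoffel vector (at points where `G x` is invertible).
[cite: HawkingEllis1973CUP, §7.5 (7.42)] -/
theorem gaugeFun_eq_apply_contrChr (hx : (G x).IsInvertible) (W : E) :
    gaugeFun b G x W = G x (∑ k, ∑ l, ginv G b x k l • chrAt G x (b k) (b l)) W := by
  rw [gaugeFun_eq b hx]
  simp only [map_sum, map_smul, FunLike.coe_sum, Finset.sum_apply, FunLike.coe_smul,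
    Pi.smul_apply, smul_eq_mul]

/-- **Harmonic coordinates have vanishing contracted Christoffel vector**: if `□_g bᵃ = 0` at `x`
for every coordinate function, then `Σ g^{kl} Γ(b_k, b_l) = 0` at `x`.
[cite: HawkingEllis1973CUP, §7.5, (7.42) and (7.51)] -/
theorem contrChr_eq_zero_of_lapAt_coordCLM_eq_zero
    (h : ∀ a, lapAt G (coordCLM b a : E → ℝ) x = 0) :
    ∑ k, ∑ l, ginv G b x k l • chrAt G x (b k) (b l) = 0 := by
  refine b.ext_elem fun a ↦ ?_
  rw [← Basis.coord_apply, coord_contrChr, h a, neg_zero, map_zero]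
  rfl

variable {G x} in
/-- **Harmonic coordinates are wave-gauge coordinates** (pointwise): if `□_g bᵃ = 0` at `x` for
every coordinate function `bᵃ` and `G x` is invertible, then the lowered contracted Christoffel
symbols vanish, `Γ♭(x, W) = 0` for all `W` — the hypothesis of the wave-gauge form of the vacuum
equations `IsMetricOn.ricAt_eq_of_gaugeFun_eq_zero`.
[cite: HawkingEllis1973CUP, §7.5, (7.42)–(7.46) and (7.51)] -/
theorem gaugeFun_eq_zero_of_lapAt_coordCLM_eq_zero (hx : (G x).IsInvertible)
    (h : ∀ a, lapAt G (coordCLM b a : E → ℝ) x = 0) (W : E) : gaugeFun b G x W = 0 := by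
  rw [gaugeFun_eq_apply_contrChr b hx, contrChr_eq_zero_of_lapAt_coordCLM_eq_zero b G x h,
    map_zero]
  rfl

variable {G x} in
/-- Conversely, **wave-gauge coordinates are harmonic**: if `Γ♭(x, ·) = 0` and `G x` is
invertible, then `□_g bᵃ = 0` at `x` for every `a`. [cite: HawkingEllis1973CUP, §7.5, (7.42) and (7.51)] -/
theorem lapAt_coordCLM_eq_zero_of_gaugeFun_eq_zero (hx : (G x).IsInvertible)
    (h : ∀ W, gaugeFun b G x W = 0) (a : ι) : lapAt G (coordCLM b a : E → ℝ) x = 0 := by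
  have h0 : G x (∑ k, ∑ l, ginv G b x k l • chrAt G x (b k) (b l)) = 0 := by
    ext W
    rw [← gaugeFun_eq_apply_contrChr b hx, h W]
    rfl
  have hc : ∑ k, ∑ l, ginv G b x k l • chrAt G x (b k) (b l) = 0 := by
    have := congrArg (sharpAt G x) h0
    rwa [sharpAt_apply hx, map_zero] at this
  rw [lapAt_coordCLM, hc, map_zero, neg_zero]

variable {G} in
/-- **Local version**: if the coordinate functions are `g`-harmonic on a set `U` on which `G` is
invertible, the contracted Christoffel symbols vanish on `U` (the open-set hypothesis `hΓ` of
`IsMetricOn.ricAt_eq_of_gaugeFun_eq_zero`). [cite: HawkingEllis1973CUP, §7.5, (7.42)–(7.46)] -/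
theorem gaugeFun_eq_zero_on_of_lapAt_coordCLM_eq_zero {U : Set E}
    (hinv : ∀ y ∈ U, (G y).IsInvertible)
    (h : ∀ y ∈ U, ∀ a, lapAt G (coordCLM b a : E → ℝ) y = 0) :
    ∀ y ∈ U, ∀ W, gaugeFun b G y W = 0 :=
  fun y hy W ↦ gaugeFun_eq_zero_of_lapAt_coordCLM_eq_zero b (hinv y hy) (h y hy) W

end MetricCoord

end Literature.Geometry.Lorentzian

end
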